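import Summits.Ventures.CertifiedArithmetic.Expansions.Orient2dEstimate
import Literature.ComputerArithmetic.Shewchuk1997.FastExpansionSum
import Literature.ComputerArithmetic.BoldoJeannerodMelquiondMuller2023.ExactAddition
import Literature.ComputerArithmetic.BoldoJeannerodMelquiondMuller2023.DirectedRoundings
import Mathlib.Tactic.Linarith
import Mathlib.Tactic.Positivity
import Mathlib.Tactic.Ring
import Mathlib.Tactic.NormNum

/-!
# APPROXIMATE is a faithful rounding on every NONADJACENT expansion

NEW WORK, HONEST FRAMING: a modest, fully checked observation about the APPROXIMATE procedure
of Shewchuk 1997 §2.8 (`estimate`: add the components in increasing order, one rounded addition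
each); it is not in that paper and we know of no printed statement of it (the printed neighbour,
faithfully rounded summation of ARBITRARY summands — Rump–Ogita–Oishi 2008, AccSum — is a
different, costlier algorithm; here the plain loop is already faithful). Setting: precision-`p`
binary floats with gradual underflow (`IsFloat p emin`), ANY round-to-nearest `fl`
(`IsRoundNearest`; no tie-breaking rule assumed), ANY `p ≥ 1`, and a NONADJACENT expansion `e`
of floats, smallest first, zeros allowed (`IsExpansion 2 e`: each component is, in magnitude,
less than half the grid unit of every later one).

Main result (`estimate_faithful_of_nonadjacent`): `estimate fl e` is a FAITHFUL ROUNDING of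
`Σ e` (`IsFaithful`, Boldo–Jeannerod–Melquiond–Muller 2023 §2.1): it is `RD (Σ e)` or
`RU (Σ e)`, a float with no float strictly between it and the exact value — so it is exact when
`Σ e` is a float, has exactly the sign of `Σ e`, and errs by `< ulp (Σ e)`. Nonadjacency is
what GROW-EXPANSION, EXPANSION-SUM, SCALE-EXPANSION and COMPRESS preserve or produce under
round-half-to-even (Shewchuk's Theorems 10, 12, 19, 23, all restated in the tree); in particular
`estimate_compress_isFaithful` re-derives in three lines, for every `p ≥ 2`, the statement of
`EstimateCompressed.lean` (there `p ≥ 3`, via `|Σ rest| < ulp L`). The hypothesis cannot be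
weakened to nonoverlapping (`IsExpansion 1`) or to Shewchuk's strongly nonoverlapping (the
output class of FAST-EXPANSION-SUM): `⟨15/16, 15, −16⟩` is a nonoverlapping expansion of
precision-4 floats with sum `−1/16` on which APPROXIMATE returns `0`, and on strongly
nonoverlapping input the error reaches `≈ (5/2)·2^-p·|Σ| > ulp Σ` (`EstimateErrorBoundWeak.lean`).

Proof. Write `e = rest ++ [L]`, `L = M·2^v`, `M` odd; nonadjacency gives `2|x| < 2^v` on `rest`,
so (Lemma E, a joint induction) the running value `Q` has `|Q| ≤ m := 2^v/2` and
`|Q − Σ rest| ≤ θ := 2^v·2^-p/3`. With `σ` the sign of `L`: `σ(Q + L) ≥ m` and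
`σ(Σ e) ≥ m − θ`. A float of magnitude `> m − m·2^-p` has magnitude `≥ m` (float spacing just
below the power of two `m`), so every float between `Σ e` and `Q + L`, and `fl (Q + L)` itself,
is a multiple of `2^(v-p)`; as `2θ < 2^(v-p)`, round-to-nearest minimality forbids a float
strictly between `Σ e` and `fl (Q + L)`. (When `v = emin` every float is a multiple of
`2^emin`; a zero top component is discarded.)

NOT CLAIMED: round-to-nearest. With `p = 4`, `e = ⟨60, 1920, −61440, 131072⟩` is nonadjacent
with sum `71612`; APPROXIMATE returns `65536 = RD 71612` while `RN 71612 = 73728`. Evidence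
beyond the proof (exact integer models): exhaustive `p = 2,3,4` over small exponent ranges
(594 582 inputs) and 2.1·10^6 random nonadjacent inputs with up to 14 components,
`p ∈ {4,5,6,8,11}`, four tie-breaking rules: never unfaithful; largest error seen `≈ 0.79 ulp`.
-/

namespace Summit.Ventures.CertifiedArithmetic.Expansions

open Literature.ComputerArithmetic.JeannerodRump2018
open Literature.ComputerArithmetic.BoldoJeannerodMelquiondMuller2023 hiding twoSum twoSum_fst
open Literature.ComputerArithmetic.JoldesMullerPopescu2017 (isFloat_two_zpow abs_fl_le_of_abs_le)
open Literature.ComputerArithmetic.Shewchuk1997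

variable {p : ℕ} {emin : ℤ} {fl : ℚ → ℚ}

/-- `2 ≤ 2^p` for `p ≥ 1`. -/
private theorem two_le_two_pow (hp : 1 ≤ p) : (2 : ℚ) ≤ 2 ^ p := by
  calc (2 : ℚ) = 2 ^ 1 := by norm_num
    _ ≤ 2 ^ p := pow_le_pow_right₀ (by norm_num) hp

/-- Unfolding `estimate` at the top component. -/
private theorem estimate_snoc' (fl : ℚ → ℚ) {l : List ℚ} (hl : l ≠ []) (x : ℚ) :
    estimate fl (l ++ [x]) = fl (estimate fl l + x) := by
  obtain ⟨e, es, rfl⟩ := List.exists_cons_of_ne_nil hl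
  simp [estimate, List.foldl_append]

/-- `estimate` of a list of floats is a float. -/
private theorem estimate_isFloat' (hfl : IsRoundNearest p emin fl) :
    ∀ {l : List ℚ}, (∀ x ∈ l, IsFloat p emin x) → IsFloat p emin (estimate fl l) := by
  intro l
  induction l using List.reverseRecOn with
  | nil => intro; exact ⟨0, emin, by simp, le_rfl, by simp [estimate]⟩
  | append_singleton l a _ =>
    intro h
    by_cases hl : l = []
    · subst hl; simpa [estimate] using h a (by simp)
    · rw [estimate_snoc' fl hl]; exact (hfl _).1

/-- Round-to-nearest moves a point of the float grid `2^emin` of magnitude `< 2^g` by at most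
`2^g·2^-p/2` (when `2^(g-p) < 2^emin` such a point is a float and does not move at all). -/
private theorem abs_fl_sub_le_half' (hp : 1 ≤ p) (hfl : IsRoundNearest p emin fl) {t : ℚ}
    (htg : OnGrid emin t) {g : ℤ} (ht : |t| < (2 : ℚ) ^ g) :
    |fl t - t| ≤ (2 : ℚ) ^ g / 2 ^ p / 2 := by
  have h2ne : (2 : ℚ) ≠ 0 := by norm_num
  have hgp : (2 : ℚ) ^ (g - p) = (2 : ℚ) ^ g / 2 ^ p := by rw [zpow_sub₀ h2ne, zpow_natCast]
  rcases lt_or_ge (g - p) emin with hg | hg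
  · obtain ⟨r, hr⟩ := htg
    have h2e : (0 : ℚ) < (2 : ℚ) ^ emin := zpow_pos (by norm_num) _
    have hlt : |t| < (2 : ℚ) ^ p * (2 : ℚ) ^ emin := by
      rw [← zpow_natCast, ← zpow_add₀ h2ne]
      exact ht.trans_le (zpow_le_zpow_right₀ (by norm_num) (by omega))
    rw [hr, abs_mul, abs_of_pos h2e] at hlt
    have hr' : |r| ≤ (2 : ℤ) ^ p := by exact_mod_cast (lt_of_mul_lt_mul_right hlt h2e.le).le
    rw [fl_eq_self hfl (hr ▸ isFloat_of_abs_le hp hr' le_rfl), sub_self, abs_zero, ← hgp]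
    exact div_nonneg (zpow_pos (by norm_num) _).le (by norm_num)
  · rw [abs_sub_comm, ← hgp]
    refine (abs_sub_fl_le_half_ulp hp hfl t).trans (div_le_div_of_nonneg_right ?_ (by norm_num))
    by_cases ht0 : t = 0
    · rw [ht0, ulp_zero]; exact zpow_le_zpow_right₀ (by norm_num) hg
    · rw [ulp_of_ne_zero ht0]
      refine zpow_le_zpow_right₀ (by norm_num) (max_le hg ?_)
      by_contra hlt
      have h1 := zpow_log_le_abs ht0
      have h2 : (2 : ℚ) ^ g ≤ (2 : ℚ) ^ (Int.log 2 |t|) :=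
        zpow_le_zpow_right₀ (by norm_num) (by omega)
      linarith

/-- **Lemma E.** On a nonadjacent expansion of floats with `2|x| < 2^s` for every component:
`|estimate| ≤ 2^s/2` and `|estimate − Σ| ≤ 2^s·2^-p/3`, for any round-to-nearest. (A private
copy of `estimate_bounds_of_nonadjacent` of `EstimateCompressed.lean`, not importable here.) -/
private theorem bounds_of_nonadjacent (hp : 1 ≤ p) (hfl : IsRoundNearest p emin fl) :
    ∀ {l : List ℚ}, (∀ x ∈ l, IsFloat p emin x) → IsExpansion 2 l →
      ∀ {s : ℤ}, (∀ x ∈ l, 2 * |x| < (2 : ℚ) ^ s) →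
        |estimate fl l| ≤ (2 : ℚ) ^ s / 2 ∧
          |estimate fl l - l.sum| ≤ (2 : ℚ) ^ s / 2 ^ p / 3 := by
  have h2ne : (2 : ℚ) ≠ 0 := by norm_num
  have hP : (0 : ℚ) < (2 : ℚ) ^ p := by positivity
  intro l
  induction l using List.reverseRecOn with
  | nil =>
    intro _ _ s _
    have h2s : (0 : ℚ) < (2 : ℚ) ^ s := zpow_pos (by norm_num) _
    rw [show estimate fl ([] : List ℚ) = 0 from rfl, List.sum_nil, sub_self, abs_zero]
    exact ⟨by linarith, div_nonneg (div_nonneg h2s.le hP.le) (by norm_num)⟩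
  | append_singleton l a ih =>
    intro hF hE s hs
    have hFl : ∀ x ∈ l, IsFloat p emin x := fun x hx => hF x (List.mem_append_left _ hx)
    have hFa : IsFloat p emin a := hF a (by simp)
    have hEl : IsExpansion 2 l := (List.pairwise_append.mp hE).1
    have hbelow : ∀ x ∈ l, Below 2 x a := fun x hx =>
      (List.pairwise_append.mp hE).2.2 x hx a (by simp)
    have hsl : ∀ x ∈ l, 2 * |x| < (2 : ℚ) ^ s := fun x hx => hs x (List.mem_append_left _ hx)
    have hsa : 2 * |a| < (2 : ℚ) ^ s := hs a (by simp)
    have h2s : (0 : ℚ) < (2 : ℚ) ^ s := zpow_pos (by norm_num) _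
    by_cases hl : l = []
    · subst hl
      rw [List.nil_append, show estimate fl [a] = a from rfl, List.sum_singleton, sub_self,
        abs_zero]
      exact ⟨by linarith, div_nonneg (div_nonneg h2s.le hP.le) (by norm_num)⟩
    rw [estimate_snoc' fl hl, List.sum_append, List.sum_singleton]
    set Q := estimate fl l with hQdef
    have hQF : IsFloat p emin Q := estimate_isFloat' hfl hFl
    by_cases ha0 : a = 0
    · rw [ha0, add_zero, add_zero, fl_eq_self hfl hQF]; exact ih hFl hEl hsl
    obtain ⟨M, v, hMo, -, hev, hav⟩ := exists_odd_mul_two_zpow hFa ha0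
    have h2v : (0 : ℚ) < (2 : ℚ) ^ v := zpow_pos (by norm_num) _
    have hv : ∀ x ∈ l, 2 * |x| < (2 : ℚ) ^ v := fun x hx => by
      obtain ⟨s', hs', hxs'⟩ := hbelow x hx
      rw [hav] at hs'
      exact hxs'.trans_le (zpow_le_zpow_right₀ (by norm_num) (OnGrid.le_of_odd hMo hs'))
    obtain ⟨hQv, hEv⟩ := ih hFl hEl hv
    have hag : OnGrid v a := ⟨M, hav⟩
    have hva : (2 : ℚ) ^ v ≤ |a| := hag.two_zpow_le_abs ha0
    have hs1 : (2 : ℚ) ^ (s - 1) = (2 : ℚ) ^ s / 2 := by rw [zpow_sub_one₀ h2ne]; ring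
    have halt : |a| < (2 : ℚ) ^ (s - 1) := by rw [hs1]; linarith
    have hvs : v < s - 1 := (zpow_lt_zpow_iff_right₀ one_lt_two).mp (hva.trans_lt halt)
    have hsum : |a| + (2 : ℚ) ^ v ≤ (2 : ℚ) ^ (s - 1) :=
      hag.abs.add_two_zpow_le (OnGrid.two_zpow (by omega)) halt
    set T := Q + a with hTdef
    have hTle : |T| ≤ (2 : ℚ) ^ (s - 1) - (2 : ℚ) ^ v / 2 := by
      have : |T| ≤ |Q| + |a| := abs_add_le _ _
      linarith
    have hTg : OnGrid emin T := (OnGrid.of_isFloat hQF).add (OnGrid.of_isFloat hFa)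
    have herr : |fl T - T| ≤ (2 : ℚ) ^ (s - 1) / 2 ^ p / 2 :=
      abs_fl_sub_le_half' hp hfl hTg (by linarith)
    rw [hs1] at herr
    have hv4 : (2 : ℚ) ^ v ≤ (2 : ℚ) ^ s / 4 := by
      have h1 : (2 : ℚ) ^ v ≤ (2 : ℚ) ^ (s - 2) := zpow_le_zpow_right₀ (by norm_num) (by omega)
      have h2 : (2 : ℚ) ^ (s - 2) = (2 : ℚ) ^ s / 4 := by rw [zpow_sub₀ h2ne]; norm_num
      linarith
    have hcap : |fl T| ≤ (2 : ℚ) ^ s / 2 := by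
      rw [← hs1]
      exact abs_fl_le_of_abs_le hfl (isFloat_two_zpow hp (by omega)) (by linarith)
    refine ⟨hcap, ?_⟩
    have hsplit : fl T - (l.sum + a) = (fl T - T) + (Q - l.sum) := by rw [hTdef]; ring
    rw [hsplit]
    refine (abs_add_le _ _).trans ?_
    have hEv' : |Q - l.sum| ≤ (2 : ℚ) ^ s / 4 / 2 ^ p / 3 :=
      hEv.trans (div_le_div_of_nonneg_right (div_le_div_of_nonneg_right hv4 hP.le) (by norm_num))
    have hfin : (2 : ℚ) ^ s / 2 / 2 ^ p / 2 + (2 : ℚ) ^ s / 4 / 2 ^ p / 3 =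
        (2 : ℚ) ^ s / 2 ^ p / 3 := by
      field_simp; ring
    linarith

/-- **The grid argument.** `|T − S| ≤ θ`; if `fl T` and every float between `S` and `T` lie on
a grid `2^g` with `2θ < 2^g`, then no float lies strictly between `S` and `fl T` (minimality of
round-to-nearest puts `T` beyond such a float `F`, whence `|fl T − F| ≤ 2θ < 2^g ≤ |fl T − F|`). -/
private theorem isFaithful_of_grid' (hfl : IsRoundNearest p emin fl) {T S θ : ℚ} {g : ℤ}
    (hθ : |T - S| ≤ θ) (hθg : 2 * θ < (2 : ℚ) ^ g) (hAg : OnGrid g (fl T))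
    (hFg : ∀ F : ℚ, IsFloat p emin F → min S T ≤ F → F ≤ max S T → OnGrid g F) :
    IsFaithful p emin S (fl T) := by
  have hA : IsFloat p emin (fl T) := (hfl T).1
  have h1 : fl T - T ≤ |T - fl T| := by rw [abs_sub_comm]; exact le_abs_self _
  have h2 : T - fl T ≤ |T - fl T| := le_abs_self _
  have hθ1 : T - S ≤ θ := (le_abs_self _).trans hθ
  have hθ2 : S - T ≤ θ := by linarith [neg_abs_le (T - S)]
  rcases le_total S (fl T) with hSA | hAS
  · -- `S ≤ fl T`: `fl T = RU S`, i.e. no float `F` with `S ≤ F < fl T`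
    refine Or.inr ⟨hA, hSA, fun F hF hSF => not_lt.mp fun hFA => ?_⟩
    have hmin : |T - fl T| ≤ |T - F| := (hfl T).2 F hF
    have hTF : F < T := not_le.mp fun hle => by
      rw [abs_of_nonpos (sub_nonpos.mpr hle)] at hmin
      linarith
    rw [abs_of_pos (sub_pos.mpr hTF)] at hmin
    have hFg' : OnGrid g F := hFg F hF (min_le_of_left_le hSF) (le_max_of_le_right hTF.le)
    have hgap := OnGrid.add_two_zpow_le hFg' hAg hFA
    linarith
  · -- `fl T ≤ S`: `fl T = RD S`, i.e. no float `F` with `fl T < F ≤ S`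
    refine Or.inl ⟨hA, hAS, fun F hF hFS => not_lt.mp fun hAF => ?_⟩
    have hmin : |T - fl T| ≤ |T - F| := (hfl T).2 F hF
    have hTF : T < F := not_le.mp fun hle => by
      rw [abs_of_nonneg (sub_nonneg.mpr hle)] at hmin
      linarith
    rw [abs_of_neg (sub_neg.mpr hTF)] at hmin
    have hFg' : OnGrid g F := hFg F hF (min_le_of_right_le hTF.le) (le_max_of_le_left hFS)
    have hgap := OnGrid.add_two_zpow_le hAg hFg' hAF
    linarith

/-- **Float spacing below a power of two**: a float of magnitude `> 2^j − 2^j·2^-p` has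
magnitude `≥ 2^j` (the floats in `[2^(j-1), 2^j)` are the multiples `K·2^(j-p)`, `K < 2^p`). -/
private theorem two_zpow_le_abs_of_lt (hp : 1 ≤ p) {F : ℚ} (hF : IsFloat p emin F) {j : ℤ}
    (h : (2 : ℚ) ^ j - (2 : ℚ) ^ j / 2 ^ p < |F|) : (2 : ℚ) ^ j ≤ |F| := by
  have h2ne : (2 : ℚ) ≠ 0 := by norm_num
  have hP : (0 : ℚ) < (2 : ℚ) ^ p := by positivity
  have h2j : (0 : ℚ) < (2 : ℚ) ^ j := zpow_pos (by norm_num) _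
  refine not_lt.mp fun hlt => ?_
  have hj1 : (2 : ℚ) ^ (j - 1) = (2 : ℚ) ^ j / 2 := by rw [zpow_sub_one₀ h2ne]; ring
  have hhalf : (2 : ℚ) ^ j / 2 ^ p ≤ (2 : ℚ) ^ j / 2 :=
    div_le_div_of_nonneg_left h2j.le (by norm_num) (two_le_two_pow hp)
  have hE : (2 : ℚ) ^ (j - 1) ≤ |F| := by rw [hj1]; linarith
  obtain ⟨K, hK⟩ := exists_eq_int_mul_two_zpow_of_isFloat hF hE
  have hjp : (2 : ℚ) ^ (j - 1 - p + 1) = (2 : ℚ) ^ j / 2 ^ p := by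
    rw [show j - 1 - (p : ℤ) + 1 = j - p by ring, zpow_sub₀ h2ne, zpow_natCast]
  rw [hjp] at hK
  have hq : (0 : ℚ) < (2 : ℚ) ^ j / 2 ^ p := div_pos h2j hP
  have hFabs : |F| = |(K : ℚ)| * ((2 : ℚ) ^ j / 2 ^ p) := by rw [hK, abs_mul, abs_of_pos hq]
  have h2jP : (2 : ℚ) ^ j = (2 : ℚ) ^ p * ((2 : ℚ) ^ j / 2 ^ p) := by field_simp
  have hKlt : |(K : ℚ)| < (2 : ℚ) ^ p :=
    lt_of_mul_lt_mul_right (by rw [← hFabs, ← h2jP]; exact hlt) hq.le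
  have hKle : |(K : ℚ)| ≤ (2 : ℚ) ^ p - 1 := by
    have : |K| ≤ (2 : ℤ) ^ p - 1 := by
      have : |K| < (2 : ℤ) ^ p := by exact_mod_cast hKlt
      omega
    exact_mod_cast this
  have : |F| ≤ (2 : ℚ) ^ j - (2 : ℚ) ^ j / 2 ^ p := by
    rw [hFabs]
    have := mul_le_mul_of_nonneg_right hKle hq.le
    rwa [sub_mul, one_mul, ← h2jP] at this
  linarith

/-- **APPROXIMATE is a faithful rounding on every nonadjacent expansion** (any precision
`p ≥ 1`, any round-to-nearest). For floats forming a nonadjacent expansion, `estimate fl e` is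
`RD (Σ e)` or `RU (Σ e)`: a float with no float strictly between it and the exact value. -/
theorem estimate_faithful_of_nonadjacent (hp : 1 ≤ p) (hfl : IsRoundNearest p emin fl) :
    ∀ {e : List ℚ}, (∀ x ∈ e, IsFloat p emin x) → IsExpansion 2 e →
      IsFaithful p emin e.sum (estimate fl e) := by
  have h2ne : (2 : ℚ) ≠ 0 := by norm_num
  have hP : (0 : ℚ) < (2 : ℚ) ^ p := by positivity
  intro e
  induction e using List.reverseRecOn with
  | nil =>
    intro _ _
    rw [show estimate fl ([] : List ℚ) = 0 from rfl, List.sum_nil]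
    exact Or.inl (isRD_self (isFloat_zero p emin))
  | append_singleton rest L ih =>
    intro hF hE
    have hrF : ∀ x ∈ rest, IsFloat p emin x := fun x hx => hF x (List.mem_append_left _ hx)
    have hLF : IsFloat p emin L := hF L (by simp)
    have hEr : IsExpansion 2 rest := (List.pairwise_append.mp hE).1
    have hbelow : ∀ x ∈ rest, Below 2 x L := fun x hx =>
      (List.pairwise_append.mp hE).2.2 x hx L (by simp)
    rw [List.sum_append, List.sum_singleton]
    by_cases hr : rest = []
    · subst hr
      rw [List.nil_append, show estimate fl [L] = L from rfl, List.sum_nil, zero_add]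
      exact Or.inl (isRD_self hLF)
    rw [estimate_snoc' fl hr]
    set Q := estimate fl rest with hQdef
    set R := rest.sum with hRdef
    have hQF : IsFloat p emin Q := estimate_isFloat' hfl hrF
    by_cases hL0 : L = 0
    · rw [hL0, add_zero, add_zero, fl_eq_self hfl hQF]; exact ih hrF hEr
    obtain ⟨M, v, hMo, -, hev, hLv⟩ := exists_odd_mul_two_zpow hLF hL0
    have h2v : (0 : ℚ) < (2 : ℚ) ^ v := zpow_pos (by norm_num) _
    have hv : ∀ x ∈ rest, 2 * |x| < (2 : ℚ) ^ v := fun x hx => by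
      obtain ⟨s', hs', hxs'⟩ := hbelow x hx
      rw [hLv] at hs'
      exact hxs'.trans_le (zpow_le_zpow_right₀ (by norm_num) (OnGrid.le_of_odd hMo hs'))
    obtain ⟨hQv, hθ⟩ := bounds_of_nonadjacent hp hfl hrF hEr hv
    have hvL : (2 : ℚ) ^ v ≤ |L| := (show OnGrid v L from ⟨M, hLv⟩).two_zpow_le_abs hL0
    have hq : (0 : ℚ) < (2 : ℚ) ^ v / 2 ^ p := div_pos h2v hP
    have hm : (2 : ℚ) ^ (v - 1) = (2 : ℚ) ^ v / 2 := by rw [zpow_sub_one₀ h2ne]; ring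
    have hg : (2 : ℚ) ^ (v - p) = (2 : ℚ) ^ v / 2 ^ p := by rw [zpow_sub₀ h2ne, zpow_natCast]
    have hqm : (2 : ℚ) ^ v / 2 ^ p ≤ (2 : ℚ) ^ v / 2 :=
      div_le_div_of_nonneg_left h2v.le (by norm_num) (two_le_two_pow hp)
    have hθ' : |Q + L - (R + L)| ≤ (2 : ℚ) ^ v / 2 ^ p / 3 := by
      rwa [show Q + L - (R + L) = Q - R by ring]
    have hRle : |R| ≤ (2 : ℚ) ^ v / 2 + (2 : ℚ) ^ v / 2 ^ p / 3 := by
      linarith [abs_sub_abs_le_abs_sub R Q, abs_sub_comm R Q]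
    have key : (2 : ℚ) ^ v / 2 ≤ |Q + L| ∧ ∀ F : ℚ, min (R + L) (Q + L) ≤ F →
        F ≤ max (R + L) (Q + L) → (2 : ℚ) ^ v / 2 - (2 : ℚ) ^ v / 2 ^ p / 3 ≤ |F| := by
      rcases lt_or_gt_of_ne hL0 with hneg | hpos
      · rw [abs_of_neg hneg] at hvL
        have hT : Q + L ≤ -((2 : ℚ) ^ v / 2) := by linarith [le_abs_self Q]
        have hS : R + L ≤ -((2 : ℚ) ^ v / 2 - (2 : ℚ) ^ v / 2 ^ p / 3) := by
          linarith [le_abs_self R]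
        refine ⟨by rw [abs_of_neg (by linarith)]; linarith, fun F _ hhi => ?_⟩
        have hF : F ≤ -((2 : ℚ) ^ v / 2 - (2 : ℚ) ^ v / 2 ^ p / 3) :=
          hhi.trans (max_le hS (by linarith))
        rw [abs_of_neg (by linarith)]; linarith
      · rw [abs_of_pos hpos] at hvL
        have hT : (2 : ℚ) ^ v / 2 ≤ Q + L := by linarith [neg_abs_le Q]
        have hS : (2 : ℚ) ^ v / 2 - (2 : ℚ) ^ v / 2 ^ p / 3 ≤ R + L := by
          linarith [neg_abs_le R]
        refine ⟨by rw [abs_of_pos (by linarith)]; linarith, fun F hlo _ => ?_⟩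
        have hF : (2 : ℚ) ^ v / 2 - (2 : ℚ) ^ v / 2 ^ p / 3 ≤ F :=
          (le_min hS (by linarith)).trans hlo
        rwa [abs_of_pos (by linarith)]
    obtain ⟨hT, hFm⟩ := key
    have hθg : 2 * ((2 : ℚ) ^ v / 2 ^ p / 3) < (2 : ℚ) ^ (v - p) := by rw [hg]; linarith
    rcases eq_or_lt_of_le hev with hve | hve
    · have hgr : ∀ F : ℚ, IsFloat p emin F → OnGrid (v - p) F := fun F hF =>
        (OnGrid.of_isFloat hF).mono (by omega)
      exact isFaithful_of_grid' hfl hθ' hθg (hgr _ (hfl _).1) fun F hF _ _ => hgr F hF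
    · have hmF : IsFloat p emin ((2 : ℚ) ^ (v - 1)) := isFloat_two_zpow hp (by omega)
      have hgr : ∀ F : ℚ, IsFloat p emin F → (2 : ℚ) ^ v / 2 ≤ |F| → OnGrid (v - p) F :=
        fun F hF hle => by
          obtain ⟨K, hK⟩ := exists_eq_int_mul_two_zpow_of_isFloat hF (E := v - 1) (by rwa [hm])
          exact ⟨K, by rw [hK, show v - 1 - (p : ℤ) + 1 = v - p by ring]⟩
      have hA : (2 : ℚ) ^ v / 2 ≤ |fl (Q + L)| := by
        have := abs_le_abs_fl hfl hmF
          (show |(2 : ℚ) ^ (v - 1)| ≤ |Q + L| by rwa [abs_of_pos (zpow_pos (by norm_num) _), hm])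
        rwa [abs_of_pos (zpow_pos (by norm_num) _), hm] at this
      refine isFaithful_of_grid' hfl hθ' hθg (hgr _ (hfl _).1 hA) fun F hF hlo hhi => hgr F hF ?_
      have h1 := hFm F hlo hhi
      have h2 := two_zpow_le_abs_of_lt hp hF (j := v - 1)
        (by rw [hm, show (2 : ℚ) ^ v / 2 / 2 ^ p = (2 : ℚ) ^ v / 2 ^ p / 2 by ring]; linarith)
      rwa [hm] at h2

/-- **Exactness when the value is representable**: if `Σ e` is a float, APPROXIMATE returns it. -/
theorem estimate_eq_sum_of_nonadjacent (hp : 1 ≤ p) (hfl : IsRoundNearest p emin fl)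
    {e : List ℚ} (he : ∀ x ∈ e, IsFloat p emin x) (hexp : IsExpansion 2 e)
    (hS : IsFloat p emin e.sum) : estimate fl e = e.sum :=
  (estimate_faithful_of_nonadjacent hp hfl he hexp).eq_self hS

/-- **Error below one ulp of the exact value** (Property 2.8 of Boldo–Jeannerod–Melquiond–Muller):
`|estimate e − Σ e| < ulp (Σ e)` on a nonadjacent expansion. -/
theorem abs_estimate_sub_sum_lt_ulp_of_nonadjacent (hp : 1 ≤ p) (hfl : IsRoundNearest p emin fl)
    {e : List ℚ} (he : ∀ x ∈ e, IsFloat p emin x) (hexp : IsExpansion 2 e) :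
    |estimate fl e - e.sum| < ulp p emin e.sum :=
  abs_sub_lt_ulp_of_isFaithful hp (estimate_faithful_of_nonadjacent hp hfl he hexp)

/-- On a nonadjacent expansion APPROXIMATE has exactly the sign of the exact value — the
property it lacks on merely nonoverlapping input (`⟨15/16, 15, −16⟩ ↦ 0`). -/
theorem estimate_pos_iff_of_nonadjacent (hp : 1 ≤ p) (hfl : IsRoundNearest p emin fl)
    {e : List ℚ} (he : ∀ x ∈ e, IsFloat p emin x) (hexp : IsExpansion 2 e) :
    0 < estimate fl e ↔ 0 < e.sum := by
  have hf := estimate_faithful_of_nonadjacent hp hfl he hexp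
  refine ⟨fun hA => not_le.mp fun hS => ?_, fun hS => ?_⟩
  · exact absurd (hf.le_of_le (isFloat_zero p emin) hS) (not_le.mpr hA)
  · have hg : OnGrid emin e.sum := OnGrid.listSum fun x hx => OnGrid.of_isFloat (he x hx)
    have hle : (2 : ℚ) ^ emin ≤ e.sum := by
      have := hg.two_zpow_le_abs hS.ne'
      rwa [abs_of_pos hS] at this
    exact lt_of_lt_of_le (zpow_pos (by norm_num) _)
      (hf.ge_of_ge (isFloat_two_zpow hp le_rfl) hle)

/-- Mirror of `estimate_pos_iff_of_nonadjacent`; together they also give `= 0 ↔ Σ e = 0`. -/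
theorem estimate_neg_iff_of_nonadjacent (hp : 1 ≤ p) (hfl : IsRoundNearest p emin fl)
    {e : List ℚ} (he : ∀ x ∈ e, IsFloat p emin x) (hexp : IsExpansion 2 e) :
    estimate fl e < 0 ↔ e.sum < 0 := by
  have hf := estimate_faithful_of_nonadjacent hp hfl he hexp
  refine ⟨fun hA => not_le.mp fun hS => ?_, fun hS => ?_⟩
  · exact absurd (hf.ge_of_ge (isFloat_zero p emin) hS) (not_le.mpr hA)
  · have hg : OnGrid emin e.sum := OnGrid.listSum fun x hx => OnGrid.of_isFloat (he x hx)
    have hle : e.sum ≤ -(2 : ℚ) ^ emin := by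
      have := hg.two_zpow_le_abs hS.ne
      rw [abs_of_neg hS] at this
      linarith
    exact lt_of_le_of_lt (hf.le_of_le (isFloat_two_zpow hp le_rfl).neg hle)
      (neg_neg_of_pos (zpow_pos (by norm_num) _))

/-- **APPROXIMATE ∘ COMPRESS is a faithful rounding, for every `p ≥ 2`** (round-to-nearest with
nonadjacent roundoff, e.g. round-half-to-even): COMPRESS of a nonoverlapping expansion is a
nonadjacent expansion with the same sum (Shewchuk's Theorem 23, `compress_spec`). This sharpens
`estimate_compress_faithful` of `EstimateCompressed.lean` (`p ≥ 3`). -/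
theorem estimate_compress_isFaithful (hp : 2 ≤ p) (hfl : IsRoundNearest p emin fl)
    (hfl2 : RoundoffBelow 2 fl) {e : List ℚ} (he : ∀ x ∈ e, IsFloat p emin x)
    (hexp : IsExpansion 1 e) : IsFaithful p emin e.sum (estimate fl (compress fl e)) := by
  have out := compress_spec hp hfl (c := 2) (by norm_num) hfl2 he hexp
  rw [← out.sum_eq]
  exact estimate_faithful_of_nonadjacent (by omega) hfl out.floats out.exp

end Summit.Ventures.CertifiedArithmetic.Expansions
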